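import Literature.Barriers.AtomisticToContinuum.DisorderedHarmonicChainPhasesProofs
import Mathlib.Analysis.SpecialFunctions.Trigonometric.Arctan
import HarnessLib

/-!
# Ajanki–Huveneers 2011, Prop. 4.1 (`sup_x 𝔼(1/Γ^x_n) ≲ e^{-αw²n}`), I: the one-step estimate

Companion to `DisorderedHarmonicChainPhases.lean` / `…PhasesProofs.lean` (provefact unit for
`AjankiHuveneers2011_invGammaDecay`: O. Ajanki, F. Huveneers, CMP **301** (2011) 841–883,
arXiv:1003.1076, §4 Prop. 4.1). This file is the analytic core of the discharge; the
measure-theoretic iteration over the product law and the theorem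
`AjankiHuveneers2011_invGammaDecay_holds` are in `…InvGammaProofs.lean`. All new names carry the
prefix `ig`/`ig_` ("inverse Gamma") to keep them disjoint from the sibling files of the cluster.

## The argument (a multiplicative corrector instead of the paper's martingale route)

The paper proves Prop. 4.1 from the exponential representation (3.21) of `Γ`, Freedman's and
Azuma's martingale bounds (Lemma 4.2), Cor. 3.4 (i) and the noisy `L^p`-ergodicity of the phase
chain over one round (Lemma 4.4), splitting the two sums of (3.21) by Hölder. We discharge the
same statement by a shorter, fully explicit route:

* **Exact closed form of the amplitude factor** (implicit in App. 7.1 of the paper): with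
  `t = πw/2`, `q₀ = √(1-t²)` (`igQ0`), `S = sin πx`, `C = cos πx`, `N = 2tbS²`, `D = q₀ - 2tbSC`
  (numerator and denominator of (3.10)) one has `S·D + C·N = q₀S`, hence
  `sin π(x + Φ(x,b)) · √(D² + N²) = q₀ sin πx` (`ig_sin_pi_add_ahPhi_mul_sqrt`) and
  `1/ahFactor = 1/√(1 - 4δSC + 4δ²S²)`, `δ = c(w) b`, `c = t/q₀` (`igC`, `igDelta`; the paper's
  `δ` of App. 7.1) (`ig_ahFactor_inv_eq`, `ig_ahFactor_pos`); i.e. `ahFactor = |1 + iδ(1 - e^{-2πix})|`.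
* `1/√(1+u) ≤ 1 - u/2 + (3/8)u² + 4|u|³` for `|u| ≤ 1/2` (`ig_one_div_sqrt_one_add_le`), whence
  `1/ahFactor ≤ 1 + 2δSC + δ²S²(6C²-2) + 122|δ|³` (`ig_inv_sqrt_factor_le`). Averaging over `b`
  (`𝔼B = 0`, `𝔼B² = κ`) the second-order coefficient is `κ q(x)`,
  `q = (π²/4)S²(6C²-2) = (π²/2)S²(2-3S²) = s²/2 - r` (`igQ`; `s`, `r` of (3.21)) with
  `∫_𝕋 q = -π²/16 < 0`, but `q` changes sign: one step alone does not contract.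
* **Corrector.** `G(y) = (3π/64) sin 4πy - (π/8) sin 2πy` (`igCorr`, derivative `igCorrDeriv`)
  solves the cell problem `G' = -(q - ∫q)`: `q + G' ≡ -π²/16` (`igQ_add_igCorrDeriv`). With
  `V = e^{wκG}` and the step `X' - x = ϑ + Φ = w(1 + b sin²πx) + 𝒪(w²)` ((3.11)/Cor. 3.4 (i),
  `ig_ahStep_displacement` from `ahPhi_expansion`), `V(X')/V(x) = 1 + w²κ(1 + bS²)G'(x) + 𝒪(w³)`
  (`ig_exp_corr_diff_le`), so that pointwise in `b ∈ [b₋, b₊]`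
  `(1/ahFactor) · V(X')/V(x) ≤ 1 + 2cbSC + c²b²S²(6C²-2) + w²κ(1 + bS²)G'(x) + K w³`
  (`ig_oneStep_core`, `ig_oneStep_pointwise`; `K = igK κ M K_e L`), and the average of the bracket
  against any law with `∫τ = 1`, `∫bτ = 0`, `∫b²τ = κ` is
  `1 + w²κ(q + G') + 𝒪(w³) = 1 - κπ²w²/16 + 𝒪(w³) ≤ e^{-κπ²w²/32}` (`ig_oneStep_avg`).
  Iterating (next file) gives `𝔼(1/Γ^x_n) ≤ e^{2κ+α} e^{-αw²n}` with `α = κπ²/32 = 𝔼(B²)π²/32`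
  (any `α < 𝔼(B²)π²/16` would do; the paper's (4.13) exhibits the rate as the gap between
  `∫_𝕋 r = π²/8` and `p(1-ε)‖s‖²_∞/2`).

[cite: AjankiHuveneers2011, §4 Prop. 4.1 eq. (4.1); Lemma 3.2 eq. (3.10); Prop. 3.5 eq. (3.19); App. 7.1]
-/

noncomputable section

open Real MeasureTheory

namespace Literature.Barriers.AtomisticToContinuum.HeatConduction

/-! ### The exact closed form of the amplitude factor -/

/-- `q₀(w) = √(1 - (πw/2)²)` (`= cos` of half the mean rotation: `sin πϑ = πw q₀`).
[cite: AjankiHuveneers2011, Lemma 3.2 eq. (3.10)] -/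
def igQ0 (w : ℝ) : ℝ := Real.sqrt (1 - (π * w / 2) ^ 2)

/-- `c(w) = (πw/2)/√(1 - (πw/2)²)` (`= πw/2 + 𝒪(w³)`), the noise amplitude per unit reduced mass:
`δ = c(w) b`. [cite: AjankiHuveneers2011, App. 7.1 (def. of `δ`)] -/
def igC (w : ℝ) : ℝ := π * w / 2 / igQ0 w

/-- The paper's `δ = (πw/2) b/√(1 - (πw/2)²)`. [cite: AjankiHuveneers2011, App. 7.1 (def. of `δ`)] -/
def igDelta (w b : ℝ) : ℝ := igC w * b

/-- `q₀ > 0` for `πw/2 < 1`, `w ≥ 0`. [folklore] -/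
theorem igQ0_pos {w : ℝ} (hw0 : 0 ≤ w) (hw : π * w / 2 < 1) : 0 < igQ0 w := by
  unfold igQ0
  apply Real.sqrt_pos.mpr
  have : 0 ≤ π * w / 2 := by positivity
  nlinarith

/-- `q₀ ≤ 1`. [folklore] -/
theorem igQ0_le_one (w : ℝ) : igQ0 w ≤ 1 := by
  unfold igQ0
  calc Real.sqrt (1 - (π * w / 2) ^ 2) ≤ Real.sqrt 1 :=
        Real.sqrt_le_sqrt (by nlinarith [sq_nonneg (π * w / 2)])
    _ = 1 := Real.sqrt_one

/-- `q₀² = 1 - (πw/2)²` for `πw/2 ≤ 1`, `w ≥ 0`. [folklore] -/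
theorem igQ0_sq {w : ℝ} (hw0 : 0 ≤ w) (hw : π * w / 2 ≤ 1) : igQ0 w ^ 2 = 1 - (π * w / 2) ^ 2 := by
  unfold igQ0
  rw [Real.sq_sqrt]
  have : 0 ≤ π * w / 2 := by positivity
  nlinarith

/-- **The key trigonometric identity behind the closed form**:
`sin π(x + Φ(x,b)) · √(D² + N²) = q₀ sin πx` (`N`, `D` the numerator and denominator of (3.10)),
because `sin πx · D + cos πx · N = q₀ sin πx`. [cite: AjankiHuveneers2011, Lemma 3.2 eq. (3.10)] -/
theorem ig_sin_pi_add_ahPhi_mul_sqrt {w x b : ℝ} (hw0 : 0 ≤ w) (hwb : π * w / 2 * (1 + |b|) < 1) :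
    Real.sin (π * (x + ahPhi w x b)) * Real.sqrt (ahDen w x b ^ 2 + ahNum w x b ^ 2) =
      igQ0 w * Real.sin (π * x) := by
  have hD := ahDen_pos (x := x) hw0 hwb
  have hNf := ahNum_eq w x b
  have hDf := ahDen_eq w x b
  set N := ahNum w x b with hN
  set D := ahDen w x b with hDdef
  have hΦ : π * ahPhi w x b = Real.arctan (N / D) := by
    simp only [hN, hDdef]
    unfold ahPhi
    field_simp
  set r := Real.sqrt (1 + (N / D) ^ 2) with hr
  have hr0 : 0 < r := Real.sqrt_pos.mpr (by positivity)
  have hsq : Real.sqrt (D ^ 2 + N ^ 2) = D * r := by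
    have : D ^ 2 + N ^ 2 = D ^ 2 * (1 + (N / D) ^ 2) := by
      field_simp
    rw [this, Real.sqrt_mul (sq_nonneg D), Real.sqrt_sq hD.le]
  rw [mul_add π x, Real.sin_add, hΦ, Real.sin_arctan, Real.cos_arctan, ← hr, hsq]
  have e1 : (Real.sin (π * x) * (1 / r) + Real.cos (π * x) * (N / D / r)) * (D * r) =
      Real.sin (π * x) * D + Real.cos (π * x) * N := by
    field_simp
  rw [e1, hNf, hDf]
  unfold igQ0
  ring

/-- `D² + N² = q₀² - 4(πw/2) q₀ b sin πx cos πx + 4(πw/2)² b² sin²πx`. [cite: AjankiHuveneers2011, Lemma 3.2 eq. (3.10)] -/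
theorem ig_ahDen_sq_add_ahNum_sq (w x b : ℝ) :
    ahDen w x b ^ 2 + ahNum w x b ^ 2 =
      igQ0 w ^ 2 - 4 * (π * w / 2) * igQ0 w * b * Real.sin (π * x) * Real.cos (π * x) +
        4 * (π * w / 2) ^ 2 * b ^ 2 * Real.sin (π * x) ^ 2 := by
  rw [ahNum_eq, ahDen_eq]
  have hq : Real.sqrt (1 - (π * w / 2) ^ 2) = igQ0 w := rfl
  rw [hq]
  have := Real.sin_sq_add_cos_sq (π * x)
  linear_combination (π ^ 2 * w ^ 2 * b ^ 2 * Real.sin (π * x) ^ 2) * this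

/-- The same in terms of `δ`: `D² + N² = q₀² (1 - 4δ sin πx cos πx + 4δ² sin²πx)`.
[cite: AjankiHuveneers2011, App. 7.1] -/
theorem ig_ahDen_sq_add_ahNum_sq_delta {w : ℝ} (hw0 : 0 ≤ w) (hw : π * w / 2 < 1) (x b : ℝ) :
    ahDen w x b ^ 2 + ahNum w x b ^ 2 =
      igQ0 w ^ 2 * (1 - 4 * igDelta w b * Real.sin (π * x) * Real.cos (π * x) +
        4 * igDelta w b ^ 2 * Real.sin (π * x) ^ 2) := by
  have hq := igQ0_pos hw0 hw
  rw [ig_ahDen_sq_add_ahNum_sq]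
  unfold igDelta igC
  field_simp

/-- `1 - 4δSC + 4δ²S² = (1 - 2δSC)² + 4δ²S⁴ > 0`. [folklore] -/
theorem ig_one_sub_delta_pos (δ x : ℝ) :
    0 < 1 - 4 * δ * Real.sin (π * x) * Real.cos (π * x) + 4 * δ ^ 2 * Real.sin (π * x) ^ 2 := by
  have h1 := Real.sin_sq_add_cos_sq (π * x)
  set S := Real.sin (π * x)
  set C := Real.cos (π * x)
  have key : 1 - 4 * δ * S * C + 4 * δ ^ 2 * S ^ 2 = (1 - 2 * δ * S * C) ^ 2 + 4 * δ ^ 2 * S ^ 4 := by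
    linear_combination (-(4 * δ ^ 2 * S ^ 2)) * h1
  rw [key]
  by_contra hneg
  push Not at hneg
  have hA : (1 - 2 * δ * S * C) ^ 2 = 0 := by nlinarith [sq_nonneg (1 - 2 * δ * S * C), sq_nonneg (δ * S ^ 2)]
  have hB : δ ^ 2 * S ^ 4 = 0 := by nlinarith [sq_nonneg (1 - 2 * δ * S * C), sq_nonneg (δ * S ^ 2)]
  have hA' : 1 - 2 * δ * S * C = 0 := pow_eq_zero_iff (n := 2) (by norm_num) |>.mp hA
  rcases mul_eq_zero.mp hB with h | h
  · have : δ = 0 := pow_eq_zero_iff (n := 2) (by norm_num) |>.mp h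
    rw [this] at hA'
    norm_num at hA'
  · have : S = 0 := pow_eq_zero_iff (n := 4) (by norm_num) |>.mp h
    rw [this] at hA'
    norm_num at hA'

/-- **Closed form of the inverse amplitude factor**:
`1/ahFactor(x,b) = 1/√(1 - 4δ sin πx cos πx + 4δ² sin²πx)` (`= |1 + iδ(1 - e^{-2πix})|⁻¹`), for
`w ≥ 0`, `(πw/2)(1 + |b|) < 1`; in particular the factor is positive and the continuous extension
by `1` at `sin πx = 0` in `ahFactor` is the value of the closed form.
[cite: AjankiHuveneers2011, Prop. 3.5 eqs. (3.14), (3.19); App. 7.1] -/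
theorem ig_ahFactor_inv_eq {w x b : ℝ} (hw0 : 0 ≤ w) (hwb : π * w / 2 * (1 + |b|) < 1) :
    (ahFactor w x b)⁻¹ = 1 / Real.sqrt (1 - 4 * igDelta w b * Real.sin (π * x) * Real.cos (π * x) +
        4 * igDelta w b ^ 2 * Real.sin (π * x) ^ 2) := by
  have hw1 : π * w / 2 < 1 := by nlinarith [abs_nonneg b, Real.pi_pos]
  have hq := igQ0_pos hw0 hw1
  set E := 1 - 4 * igDelta w b * Real.sin (π * x) * Real.cos (π * x) +
        4 * igDelta w b ^ 2 * Real.sin (π * x) ^ 2 with hE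
  have hE0 : 0 < E := ig_one_sub_delta_pos _ _
  have hsE : 0 < Real.sqrt E := Real.sqrt_pos.mpr hE0
  unfold ahFactor
  split_ifs with hS
  · have : E = 1 := by rw [hE, hS]; ring
    rw [this]
    simp
  · have key := ig_sin_pi_add_ahPhi_mul_sqrt (x := x) hw0 hwb
    rw [ig_ahDen_sq_add_ahNum_sq_delta hw0 hw1, ← hE, Real.sqrt_mul (sq_nonneg _), Real.sqrt_sq hq.le] at key
    have key' : Real.sin (π * (x + ahPhi w x b)) * Real.sqrt E = Real.sin (π * x) := by
      have : igQ0 w * (Real.sin (π * (x + ahPhi w x b)) * Real.sqrt E) = igQ0 w * Real.sin (π * x) := by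
        rw [← key]; ring
      exact mul_left_cancel₀ hq.ne' this
    have hy : Real.sin (π * (x + ahPhi w x b)) ≠ 0 := by
      intro h0
      rw [h0, zero_mul] at key'
      exact hS key'.symm
    rw [inv_div, div_eq_div_iff hS hsE.ne', one_mul, key']

/-- Positivity of the amplitude factor. [cite: AjankiHuveneers2011, Prop. 3.5 ("`Γ^x_n : Ω → ]0,∞[`")] -/
theorem ig_ahFactor_pos {w x b : ℝ} (hw0 : 0 ≤ w) (hwb : π * w / 2 * (1 + |b|) < 1) :
    0 < ahFactor w x b := by
  have h := ig_ahFactor_inv_eq (x := x) hw0 hwb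
  have hpos : 0 < (ahFactor w x b)⁻¹ := by
    rw [h]
    exact div_pos one_pos (Real.sqrt_pos.mpr (ig_one_sub_delta_pos _ _))
  exact inv_pos.mp hpos

/-! ### `1/√(1+u) ≤ 1 - u/2 + (3/8)u² + 4|u|³` and the second-order expansion of the inverse factor -/

/-- `1/√(1+u) ≤ 1 - u/2 + (3/8)u² + 4|u|³` for `|u| ≤ 1/2` (the Taylor polynomial of order two plus
a cubic majorant of the remainder; proved by squaring). [folklore] -/
theorem ig_one_div_sqrt_one_add_le {u : ℝ} (hu : |u| ≤ 1 / 2) :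
    1 / Real.sqrt (1 + u) ≤ 1 - u / 2 + 3 / 8 * u ^ 2 + 4 * |u| ^ 3 := by
  obtain ⟨hu1, hu2⟩ := abs_le.mp hu
  set p := 1 - u / 2 + 3 / 8 * u ^ 2 + 4 * |u| ^ 3 with hp
  have hp0 : 0 < p := by
    have := pow_nonneg (abs_nonneg u) 3
    nlinarith [sq_nonneg u]
  have h1u : 0 < 1 + u := by linarith
  have hkey : 1 ≤ p ^ 2 * (1 + u) := by
    rcases le_or_gt 0 u with h | h
    · have ha : |u| = u := abs_of_nonneg h
      have hp' : p = 1 - u / 2 + 3 / 8 * u ^ 2 + 4 * u ^ 3 := by rw [hp, ha]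
      have hid : p ^ 2 * (1 + u) - 1 =
          u ^ 3 * (69 / 8 + 241 / 64 * u - 55 / 64 * u ^ 2 + 19 * u ^ 3 + 16 * u ^ 4) := by
        rw [hp']; ring
      have hb : 0 ≤ 69 / 8 + 241 / 64 * u - 55 / 64 * u ^ 2 + 19 * u ^ 3 + 16 * u ^ 4 := by
        nlinarith [pow_nonneg h 3, pow_nonneg h 4]
      nlinarith [mul_nonneg (pow_nonneg h 3) hb]
    · have ha : |u| = -u := abs_of_neg h
      have hp' : p = 1 - u / 2 + 3 / 8 * u ^ 2 - 4 * u ^ 3 := by rw [hp, ha]; ring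
      have hid : p ^ 2 * (1 + u) - 1 =
          (-u) ^ 3 * (59 / 8 + 271 / 64 * u - 73 / 64 * u ^ 2 - 13 * u ^ 3 - 16 * u ^ 4) := by
        rw [hp']; ring
      have hn : 0 ≤ -u := by linarith
      have hu3 : u ^ 3 ≤ 0 := by nlinarith [pow_nonneg hn 3]
      have hu4 : u ^ 4 ≤ 1 / 16 := by nlinarith [sq_nonneg u, pow_nonneg hn 4]
      have hb : 0 ≤ 59 / 8 + 271 / 64 * u - 73 / 64 * u ^ 2 - 13 * u ^ 3 - 16 * u ^ 4 := by
        nlinarith [sq_nonneg u]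
      nlinarith [mul_nonneg (pow_nonneg hn 3) hb]
  have hsq : 1 ≤ p * Real.sqrt (1 + u) := by
    calc (1 : ℝ) = Real.sqrt 1 := Real.sqrt_one.symm
      _ ≤ Real.sqrt (p ^ 2 * (1 + u)) := Real.sqrt_le_sqrt hkey
      _ = p * Real.sqrt (1 + u) := by
          rw [Real.sqrt_mul (sq_nonneg p), Real.sqrt_sq hp0.le]
  rw [div_le_iff₀ (Real.sqrt_pos.mpr h1u)]
  exact hsq

/-- **Second-order expansion of the inverse factor with a cubic remainder**: for `|δ| ≤ 1/6`,
`1/√(1 - 4δSC + 4δ²S²) ≤ 1 + 2δSC + δ²S²(6C² - 2) + 122|δ|³` (`S = sin πx`, `C = cos πx`);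
to second order this is `e^{-w s(x) b - w² r(x) b²}` of (3.19) averaged form, cf. `igQ`.
[cite: AjankiHuveneers2011, Prop. 3.5 eq. (3.19)] -/
theorem ig_inv_sqrt_factor_le {δ : ℝ} (hδ : |δ| ≤ 1 / 6) (x : ℝ) :
    1 / Real.sqrt (1 - 4 * δ * Real.sin (π * x) * Real.cos (π * x) + 4 * δ ^ 2 * Real.sin (π * x) ^ 2) ≤
      1 + 2 * δ * Real.sin (π * x) * Real.cos (π * x) +
        δ ^ 2 * Real.sin (π * x) ^ 2 * (6 * Real.cos (π * x) ^ 2 - 2) + 122 * |δ| ^ 3 := by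
  have h1 := Real.sin_sq_add_cos_sq (π * x)
  have hSa := Real.abs_sin_le_one (π * x)
  have hCa := Real.abs_cos_le_one (π * x)
  set S := Real.sin (π * x) with hS
  set C := Real.cos (π * x) with hC
  set u := -4 * δ * S * C + 4 * δ ^ 2 * S ^ 2 with hu
  have hδ0 := abs_nonneg δ
  have hSC : |S * C| ≤ 1 / 2 := by
    rw [abs_le]
    constructor
    · nlinarith [sq_nonneg (S + C)]
    · nlinarith [sq_nonneg (S - C)]
  have hS2 : S ^ 2 ≤ 1 := by nlinarith [sq_nonneg C]
  -- |u| ≤ (8/3)|δ|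
  have hu_le : |u| ≤ 8 / 3 * |δ| := by
    have hA : |4 * δ * S * C| ≤ 2 * |δ| := by
      rw [show 4 * δ * S * C = (4 * δ) * (S * C) by ring, abs_mul, abs_mul]
      simp only [abs_of_pos (by norm_num : (0 : ℝ) < 4)]
      nlinarith [abs_nonneg (S * C)]
    have hB : |4 * δ ^ 2 * S ^ 2| ≤ 2 / 3 * |δ| := by
      rw [abs_of_nonneg (by positivity)]
      have : δ ^ 2 = |δ| ^ 2 := (sq_abs δ).symm
      rw [this]
      nlinarith [sq_nonneg S]
    calc |u| = |-(4 * δ * S * C) + 4 * δ ^ 2 * S ^ 2| := by rw [hu]; ring_nf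
      _ ≤ |-(4 * δ * S * C)| + |4 * δ ^ 2 * S ^ 2| := abs_add_le _ _
      _ ≤ 2 * |δ| + 2 / 3 * |δ| := by rw [abs_neg]; exact add_le_add hA hB
      _ = 8 / 3 * |δ| := by ring
  have hu_half : |u| ≤ 1 / 2 := by linarith
  have hE : 1 - 4 * δ * S * C + 4 * δ ^ 2 * S ^ 2 = 1 + u := by rw [hu]; ring
  rw [hE]
  refine (ig_one_div_sqrt_one_add_le hu_half).trans ?_
  -- polynomial identity for the main part
  have hid : 1 - u / 2 + 3 / 8 * u ^ 2 =
      1 + 2 * δ * S * C + δ ^ 2 * S ^ 2 * (6 * C ^ 2 - 2) - 12 * δ ^ 3 * S ^ 3 * C + 6 * δ ^ 4 * S ^ 4 := by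
    rw [hu]; ring
  -- the three remainder pieces
  have hR1 : -(12 * δ ^ 3 * S ^ 3 * C) ≤ 12 * |δ| ^ 3 := by
    have : |12 * δ ^ 3 * S ^ 3 * C| ≤ 12 * |δ| ^ 3 := by
      rw [abs_mul, abs_mul, abs_mul, abs_pow, abs_pow, abs_of_pos (by norm_num : (0 : ℝ) < 12)]
      have h3 : |S| ^ 3 ≤ 1 := pow_le_one₀ (abs_nonneg S) hSa
      calc 12 * |δ| ^ 3 * |S| ^ 3 * |C| ≤ 12 * |δ| ^ 3 * 1 * 1 := by
            gcongr
        _ = 12 * |δ| ^ 3 := by ring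
    linarith [neg_abs_le (12 * δ ^ 3 * S ^ 3 * C)]
  have hR2 : 6 * δ ^ 4 * S ^ 4 ≤ |δ| ^ 3 := by
    have hd4 : δ ^ 4 = |δ| ^ 4 := by rw [← abs_pow, abs_of_nonneg (by positivity)]
    have hS4 : S ^ 4 ≤ 1 := by nlinarith [sq_nonneg S]
    calc 6 * δ ^ 4 * S ^ 4 ≤ 6 * |δ| ^ 4 * 1 := by
          rw [hd4]; gcongr
      _ = (6 * |δ|) * |δ| ^ 3 := by ring
      _ ≤ 1 * |δ| ^ 3 := by gcongr; linarith
      _ = |δ| ^ 3 := one_mul _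
  have hR3 : 4 * |u| ^ 3 ≤ 108 * |δ| ^ 3 := by
    have : |u| ^ 3 ≤ (8 / 3 * |δ|) ^ 3 := pow_le_pow_left₀ (abs_nonneg u) hu_le 3
    nlinarith [pow_nonneg hδ0 3]
  linarith [hid, hR1, hR2, hR3, pow_nonneg hδ0 3]

/-! ### The corrector -/

/-- `q(x) = (π²/2) sin²πx (2 - 3 sin²πx)` (`= s(x)²/2 - r(x)` with `s`, `r` of (3.21); the second-order
coefficient of `𝔼_b(1/ahFactor)`; `∫_𝕋 q = -π²/16`). [cite: AjankiHuveneers2011, Prop. 3.5 eq. (3.21)] -/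
def igQ (x : ℝ) : ℝ := π ^ 2 / 2 * Real.sin (π * x) ^ 2 * (2 - 3 * Real.sin (π * x) ^ 2)

/-- The corrector `G(y) = (3π/64) sin 4πy - (π/8) sin 2πy`, the trigonometric polynomial with
`G' = -(q - ∫_𝕋 q)`. [folklore] -/
def igCorr (y : ℝ) : ℝ := 3 * π / 64 * Real.sin (4 * π * y) - π / 8 * Real.sin (2 * π * y)

/-- Its derivative `G'(y) = (3π²/16) cos 4πy - (π²/4) cos 2πy` (used only through the Taylor
inequality `igCorr_taylor`, never as a derivative). [folklore] -/
def igCorrDeriv (y : ℝ) : ℝ := 3 * π ^ 2 / 16 * Real.cos (4 * π * y) - π ^ 2 / 4 * Real.cos (2 * π * y)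

/-- **The cell problem**: `q(x) + G'(x) = -π²/16` identically. [folklore] -/
theorem igQ_add_igCorrDeriv (x : ℝ) : igQ x + igCorrDeriv x = -(π ^ 2 / 16) := by
  unfold igQ igCorrDeriv
  have h1 := Real.sin_sq_add_cos_sq (π * x)
  have h2 : Real.cos (2 * π * x) = 1 - 2 * Real.sin (π * x) ^ 2 := by
    rw [show 2 * π * x = 2 * (π * x) by ring, Real.cos_two_mul]
    linear_combination 2 * h1
  have h4 : Real.cos (4 * π * x) = 2 * Real.cos (2 * π * x) ^ 2 - 1 := by
    rw [show 4 * π * x = 2 * (2 * π * x) by ring, Real.cos_two_mul]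
  rw [h4, h2]
  ring

/-- `q(x) = (π²/4) sin²πx (6cos²πx - 2)`, the form produced by `ig_inv_sqrt_factor_le`. [folklore] -/
theorem igQ_eq (x : ℝ) :
    igQ x = π ^ 2 / 4 * Real.sin (π * x) ^ 2 * (6 * Real.cos (π * x) ^ 2 - 2) := by
  unfold igQ
  have h1 := Real.sin_sq_add_cos_sq (π * x)
  linear_combination (-(3 * π ^ 2 / 2 * Real.sin (π * x) ^ 2)) * h1

/-- `|G| ≤ 1`. [folklore] -/
theorem abs_igCorr_le (y : ℝ) : |igCorr y| ≤ 1 := by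
  unfold igCorr
  have h1 := Real.abs_sin_le_one (4 * π * y)
  have h2 := Real.abs_sin_le_one (2 * π * y)
  have hπ := Real.pi_lt_d2
  have hπ0 := Real.pi_pos
  calc |3 * π / 64 * Real.sin (4 * π * y) - π / 8 * Real.sin (2 * π * y)|
      ≤ |3 * π / 64 * Real.sin (4 * π * y)| + |π / 8 * Real.sin (2 * π * y)| := abs_sub _ _
    _ = 3 * π / 64 * |Real.sin (4 * π * y)| + π / 8 * |Real.sin (2 * π * y)| := by
        rw [abs_mul, abs_mul, abs_of_pos (by positivity : (0 : ℝ) < 3 * π / 64),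
          abs_of_pos (by positivity : (0 : ℝ) < π / 8)]
    _ ≤ 3 * π / 64 * 1 + π / 8 * 1 := by gcongr
    _ ≤ 1 := by nlinarith

/-- `|G'| ≤ 5`. [folklore] -/
theorem abs_igCorrDeriv_le (y : ℝ) : |igCorrDeriv y| ≤ 5 := by
  unfold igCorrDeriv
  have h1 := Real.abs_cos_le_one (4 * π * y)
  have h2 := Real.abs_cos_le_one (2 * π * y)
  have hπ := Real.pi_lt_d2
  have hπ0 := Real.pi_pos
  calc |3 * π ^ 2 / 16 * Real.cos (4 * π * y) - π ^ 2 / 4 * Real.cos (2 * π * y)|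
      ≤ |3 * π ^ 2 / 16 * Real.cos (4 * π * y)| + |π ^ 2 / 4 * Real.cos (2 * π * y)| := abs_sub _ _
    _ = 3 * π ^ 2 / 16 * |Real.cos (4 * π * y)| + π ^ 2 / 4 * |Real.cos (2 * π * y)| := by
        rw [abs_mul, abs_mul, abs_of_pos (by positivity : (0 : ℝ) < 3 * π ^ 2 / 16),
          abs_of_pos (by positivity : (0 : ℝ) < π ^ 2 / 4)]
    _ ≤ 3 * π ^ 2 / 16 * 1 + π ^ 2 / 4 * 1 := by gcongr
    _ ≤ 5 := by nlinarith

/-- `|sin(a + e) - sin a - e cos a| ≤ e²` for `|e| ≤ 1`. [folklore] -/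
theorem ig_abs_sin_add_sub_le {a e : ℝ} (he : |e| ≤ 1) :
    |Real.sin (a + e) - Real.sin a - e * Real.cos a| ≤ e ^ 2 := by
  have hsplit : Real.sin (a + e) - Real.sin a - e * Real.cos a =
      Real.sin a * (Real.cos e - 1) + Real.cos a * (Real.sin e - e) := by
    rw [Real.sin_add]; ring
  rw [hsplit]
  have he0 := abs_nonneg e
  have he2 : |e| ^ 2 = e ^ 2 := sq_abs e
  have hc : |Real.cos e - 1| ≤ e ^ 2 / 2 := by
    rw [abs_le]
    constructor
    · linarith [Real.one_sub_sq_div_two_le_cos (x := e)]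
    · linarith [Real.cos_le_one e, sq_nonneg e]
  have hs : |Real.sin e - e| ≤ e ^ 2 / 2 := by
    have hb := Real.sin_bound he
    have h3 : |e| ^ 3 ≤ e ^ 2 := by
      calc |e| ^ 3 = |e| * |e| ^ 2 := by ring
        _ ≤ 1 * |e| ^ 2 := by gcongr
        _ = e ^ 2 := by rw [one_mul, he2]
    have h5 : |e| ^ 5 ≤ e ^ 2 := by
      calc |e| ^ 5 = |e| ^ 3 * |e| ^ 2 := by ring
        _ ≤ 1 * |e| ^ 2 := by gcongr; exact pow_le_one₀ he0 he
        _ = e ^ 2 := by rw [one_mul, he2]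
    have : |Real.sin e - e| ≤ |Real.sin e - (e - e ^ 3 / 6)| + |e ^ 3 / 6| := by
      calc |Real.sin e - e| = |(Real.sin e - (e - e ^ 3 / 6)) + (-(e ^ 3 / 6))| := by ring_nf
        _ ≤ |Real.sin e - (e - e ^ 3 / 6)| + |-(e ^ 3 / 6)| := abs_add_le _ _
        _ = _ := by rw [abs_neg]
    have h36 : |e ^ 3 / 6| = |e| ^ 3 / 6 := by rw [abs_div, abs_pow, abs_of_pos (by norm_num : (0:ℝ) < 6)]
    rw [h36] at this
    nlinarith [sq_nonneg e]
  calc |Real.sin a * (Real.cos e - 1) + Real.cos a * (Real.sin e - e)|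
      ≤ |Real.sin a * (Real.cos e - 1)| + |Real.cos a * (Real.sin e - e)| := abs_add_le _ _
    _ = |Real.sin a| * |Real.cos e - 1| + |Real.cos a| * |Real.sin e - e| := by rw [abs_mul, abs_mul]
    _ ≤ 1 * (e ^ 2 / 2) + 1 * (e ^ 2 / 2) := by
        gcongr
        · exact Real.abs_sin_le_one a
        · exact Real.abs_cos_le_one a
    _ = e ^ 2 := by ring

/-- **Taylor inequality for the corrector**: `|G(y+h) - G(y) - h G'(y)| ≤ 40 h²` for `|h| ≤ 1/13`.
[folklore] -/
theorem igCorr_taylor {y h : ℝ} (hh : |h| ≤ 1 / 13) :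
    |igCorr (y + h) - igCorr y - h * igCorrDeriv y| ≤ 40 * h ^ 2 := by
  have hπ := Real.pi_lt_d2
  have hπ0 := Real.pi_pos
  have h4 : |4 * π * h| ≤ 1 := by
    rw [abs_mul, abs_of_pos (by positivity : (0 : ℝ) < 4 * π)]
    calc 4 * π * |h| ≤ 4 * π * (1 / 13) := by gcongr
      _ ≤ 1 := by nlinarith
  have h2 : |2 * π * h| ≤ 1 := by
    rw [abs_mul, abs_of_pos (by positivity : (0 : ℝ) < 2 * π)]
    calc 2 * π * |h| ≤ 2 * π * (1 / 13) := by gcongr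
      _ ≤ 1 := by nlinarith
  have T4 := ig_abs_sin_add_sub_le (a := 4 * π * y) h4
  have T2 := ig_abs_sin_add_sub_le (a := 2 * π * y) h2
  have hsplit : igCorr (y + h) - igCorr y - h * igCorrDeriv y =
      3 * π / 64 * (Real.sin (4 * π * y + 4 * π * h) - Real.sin (4 * π * y) - 4 * π * h * Real.cos (4 * π * y)) -
        π / 8 * (Real.sin (2 * π * y + 2 * π * h) - Real.sin (2 * π * y) - 2 * π * h * Real.cos (2 * π * y)) := by
    unfold igCorr igCorrDeriv
    rw [show 4 * π * (y + h) = 4 * π * y + 4 * π * h by ring,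
      show 2 * π * (y + h) = 2 * π * y + 2 * π * h by ring]
    ring
  rw [hsplit]
  calc |3 * π / 64 * (Real.sin (4 * π * y + 4 * π * h) - Real.sin (4 * π * y) - 4 * π * h * Real.cos (4 * π * y)) -
        π / 8 * (Real.sin (2 * π * y + 2 * π * h) - Real.sin (2 * π * y) - 2 * π * h * Real.cos (2 * π * y))|
      ≤ |3 * π / 64 * (Real.sin (4 * π * y + 4 * π * h) - Real.sin (4 * π * y) - 4 * π * h * Real.cos (4 * π * y))| +
        |π / 8 * (Real.sin (2 * π * y + 2 * π * h) - Real.sin (2 * π * y) - 2 * π * h * Real.cos (2 * π * y))| :=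
        abs_sub _ _
    _ = 3 * π / 64 * |Real.sin (4 * π * y + 4 * π * h) - Real.sin (4 * π * y) - 4 * π * h * Real.cos (4 * π * y)| +
        π / 8 * |Real.sin (2 * π * y + 2 * π * h) - Real.sin (2 * π * y) - 2 * π * h * Real.cos (2 * π * y)| := by
        rw [abs_mul, abs_mul, abs_of_pos (by positivity : (0 : ℝ) < 3 * π / 64),
          abs_of_pos (by positivity : (0 : ℝ) < π / 8)]
    _ ≤ 3 * π / 64 * (4 * π * h) ^ 2 + π / 8 * (2 * π * h) ^ 2 := by gcongr
    _ = (5 * π ^ 3 / 4) * h ^ 2 := by ring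
    _ ≤ 40 * h ^ 2 := by
        apply mul_le_mul_of_nonneg_right _ (sq_nonneg h)
        have h3 : π ^ 3 ≤ 3.15 ^ 3 := pow_le_pow_left₀ hπ0.le hπ.le 3
        norm_num at h3
        linarith

/-! ### Elementary bounds on `c(w)` -/

/-- `0 ≤ c(w)` for `w ≥ 0`, `πw/2 < 1`. [folklore] -/
theorem igC_nonneg {w : ℝ} (hw0 : 0 ≤ w) (hw : π * w / 2 < 1) : 0 ≤ igC w := by
  unfold igC
  exact div_nonneg (by positivity) (igQ0_pos hw0 hw).le

/-- `c(w) ≤ πw` for `w ≥ 0`, `πw/2 ≤ 1/2` (`q₀ ≥ 1/2`). [folklore] -/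
theorem igC_le {w : ℝ} (hw0 : 0 ≤ w) (hw : π * w / 2 ≤ 1 / 2) : igC w ≤ π * w := by
  have ht0 : 0 ≤ π * w / 2 := by positivity
  have hq := igQ0_pos hw0 (by linarith)
  have hq2 := igQ0_sq hw0 (by linarith)
  have hqhalf : 1 / 2 ≤ igQ0 w := by nlinarith
  unfold igC
  rw [div_le_iff₀ hq]
  nlinarith

/-- `0 ≤ c(w)² - (πw/2)² ≤ 2(πw/2)⁴` for `w ≥ 0`, `πw/2 ≤ 1/2` (`c² = t²/(1 - t²)`). [folklore] -/
theorem igC_sq_bounds {w : ℝ} (hw0 : 0 ≤ w) (hw : π * w / 2 ≤ 1 / 2) :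
    0 ≤ igC w ^ 2 - (π * w / 2) ^ 2 ∧ igC w ^ 2 - (π * w / 2) ^ 2 ≤ 2 * (π * w / 2) ^ 4 := by
  have ht0 : 0 ≤ π * w / 2 := by positivity
  have hq := igQ0_pos hw0 (by linarith)
  have hq2 := igQ0_sq hw0 (by linarith)
  have hc : igC w ^ 2 * igQ0 w ^ 2 = (π * w / 2) ^ 2 := by
    unfold igC
    field_simp
  set t := π * w / 2 with ht
  have ht2 : t ^ 2 ≤ 1 / 4 := by nlinarith
  -- c² (1 - t²) = t², so c² - t² = c² t² and c² ≤ t²/(1-t²) ≤ (4/3) t²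
  rw [hq2] at hc
  have hc2 : igC w ^ 2 ≤ 4 / 3 * t ^ 2 := by nlinarith [sq_nonneg (igC w)]
  constructor
  · nlinarith [sq_nonneg (igC w), sq_nonneg t]
  · nlinarith [sq_nonneg (igC w), sq_nonneg t, mul_nonneg (sq_nonneg (igC w)) (sq_nonneg t)]

/-! ### The step size `X' - x = ϑ + Φ = w(1 + b sin²πx) + 𝒪(w²)` -/

/-- **The one-step displacement** (Cor. 3.4 (i) in quantitative form): for `b ∈ [b₋, b₊]`,
`|f_b(x) - x - w(1 + b sin²πx)| ≤ K w²` and `|f_b(x) - x| ≤ L w` for `0 < w ≤ w₀`.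
[cite: AjankiHuveneers2011, Cor. 3.4 (i) with eqs. (3.15)-(3.16)] -/
theorem ig_ahStep_displacement (bm bp : ℝ) :
    ∃ w₀ : ℝ, 0 < w₀ ∧ w₀ ≤ 1 ∧ ∃ K : ℝ, 0 ≤ K ∧ ∃ L : ℝ, 0 ≤ L ∧
      ∀ w ∈ Set.Ioc 0 w₀, ∀ x : ℝ, ∀ b ∈ Set.Icc bm bp,
        |ahStep w b x - x - w * (1 + b * Real.sin (π * x) ^ 2)| ≤ K * w ^ 2 ∧
          |ahStep w b x - x| ≤ L * w := by
  obtain ⟨w₁, hw₁, C, hC⟩ := ahPhi_expansion bm bp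
  obtain ⟨M, hM⟩ : ∃ M : ℝ, M = max |bm| |bp| := ⟨_, rfl⟩
  have hM0 : 0 ≤ M := hM ▸ le_max_of_le_left (abs_nonneg _)
  refine ⟨min w₁ (1 / 5), by positivity, (min_le_right _ _).trans (by norm_num),
    1 + π / 2 * M ^ 2 + |C| * M, by positivity, 2 + M + π / 2 * M ^ 2 + |C| * M, by positivity, ?_⟩
  intro w hw x b hb
  obtain ⟨hw0, hwle⟩ := hw
  have hww₁ : w ≤ w₁ := hwle.trans (min_le_left _ _)
  have hw5 : w ≤ 1 / 5 := hwle.trans (min_le_right _ _)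
  have hw1 : w ≤ 1 := by linarith
  have hbM : |b| ≤ M := by
    rw [hM]
    rcases le_or_gt 0 b with h | h
    · rw [abs_of_nonneg h]
      exact le_trans (le_trans hb.2 (le_abs_self _)) (le_max_right _ _)
    · rw [abs_of_neg h]
      exact le_trans (le_trans (neg_le_neg hb.1) (neg_le_abs _)) (le_max_left _ _)
  have hΦ := hC w ⟨hw0, hww₁⟩ x b hb
  have hθ1 := ahTheta_ge hw0.le (by nlinarith [Real.pi_lt_d2] : π * w ≤ 2)
  have hθ2 := ahTheta_le hw0.le hw5
  have hS1 := Real.sin_sq_le_one (π * x)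
  have hS0 := sq_nonneg (Real.sin (π * x))
  have hs2 := Real.abs_sin_le_one (2 * π * x)
  set S2 := Real.sin (π * x) ^ 2 with hS2
  -- |Φ - w b S²| ≤ w² (π/2 M² + |C| M)
  have hdev : |ahPhi w x b - w * b * S2| ≤ (π / 2 * M ^ 2 + |C| * M) * w ^ 2 := by
    have hsplit : ahPhi w x b - w * b * S2 =
        (ahPhi w x b - S2 * (w * b + w ^ 2 * b ^ 2 * (π / 2) * Real.sin (2 * π * x))) +
          w ^ 2 * b ^ 2 * (π / 2) * Real.sin (2 * π * x) * S2 := by ring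
    rw [hsplit]
    refine (abs_add_le _ _).trans ?_
    have hb2 : b ^ 2 ≤ M ^ 2 := by rw [← sq_abs b]; exact pow_le_pow_left₀ (abs_nonneg b) hbM 2
    have hA : C * w ^ 3 * |b| * S2 ≤ |C| * M * w ^ 2 := by
      calc C * w ^ 3 * |b| * S2 ≤ |C| * w ^ 3 * |b| * S2 := by gcongr; exact le_abs_self C
        _ ≤ |C| * w ^ 3 * M * 1 := by gcongr
        _ = |C| * M * (w ^ 2 * w) := by ring
        _ ≤ |C| * M * (w ^ 2 * 1) := by gcongr
        _ = |C| * M * w ^ 2 := by ring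
    have hB : |w ^ 2 * b ^ 2 * (π / 2) * Real.sin (2 * π * x) * S2| ≤ π / 2 * M ^ 2 * w ^ 2 := by
      rw [abs_mul, abs_mul, abs_mul, abs_mul, abs_of_nonneg (sq_nonneg w), abs_of_nonneg (sq_nonneg b),
        abs_of_nonneg (by positivity : (0 : ℝ) ≤ π / 2), abs_of_nonneg hS0]
      calc w ^ 2 * b ^ 2 * (π / 2) * |Real.sin (2 * π * x)| * S2 ≤ w ^ 2 * M ^ 2 * (π / 2) * 1 * 1 := by gcongr
        _ = π / 2 * M ^ 2 * w ^ 2 := by ring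
    linarith [hΦ, hA, hB]
  have hstep : ahStep w b x - x = ahTheta w + ahPhi w x b := by unfold ahStep; ring
  have hθ3 : |ahTheta w - w| ≤ w ^ 2 := by
    rw [abs_le]; constructor
    · nlinarith [sq_nonneg w]
    · nlinarith
  constructor
  · have : ahStep w b x - x - w * (1 + b * S2) = (ahTheta w - w) + (ahPhi w x b - w * b * S2) := by
      rw [hstep]; ring
    rw [this]
    calc |ahTheta w - w + (ahPhi w x b - w * b * S2)| ≤ |ahTheta w - w| + |ahPhi w x b - w * b * S2| :=
          abs_add_le _ _
      _ ≤ w ^ 2 + (π / 2 * M ^ 2 + |C| * M) * w ^ 2 := add_le_add hθ3 hdev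
      _ = (1 + π / 2 * M ^ 2 + |C| * M) * w ^ 2 := by ring
  · rw [hstep]
    have hΦabs : |ahPhi w x b| ≤ (M + π / 2 * M ^ 2 + |C| * M) * w := by
      have : ahPhi w x b = (ahPhi w x b - w * b * S2) + w * b * S2 := by ring
      rw [this]
      have hw2le : w ^ 2 ≤ w := by nlinarith
      calc |ahPhi w x b - w * b * S2 + w * b * S2| ≤ |ahPhi w x b - w * b * S2| + |w * b * S2| := abs_add_le _ _
        _ ≤ (π / 2 * M ^ 2 + |C| * M) * w ^ 2 + w * M := by
            refine add_le_add hdev ?_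
            rw [abs_mul, abs_mul, abs_of_pos hw0, abs_of_nonneg hS0]
            calc w * |b| * S2 ≤ w * M * 1 := by gcongr
              _ = w * M := mul_one _
        _ ≤ (π / 2 * M ^ 2 + |C| * M) * w + w * M :=
            add_le_add (mul_le_mul_of_nonneg_left hw2le
              (by positivity : (0 : ℝ) ≤ π / 2 * M ^ 2 + |C| * M)) le_rfl
        _ = (M + π / 2 * M ^ 2 + |C| * M) * w := by ring
    have hθabs : |ahTheta w| ≤ 2 * w := by
      rw [abs_of_nonneg (by linarith)]
      nlinarith
    calc |ahTheta w + ahPhi w x b| ≤ |ahTheta w| + |ahPhi w x b| := abs_add_le _ _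
      _ ≤ 2 * w + (M + π / 2 * M ^ 2 + |C| * M) * w := add_le_add hθabs hΦabs
      _ = (2 + M + π / 2 * M ^ 2 + |C| * M) * w := by ring

/-! ### The corrector ratio `V(X')/V(x)` -/

/-- **Expansion of the corrector ratio**: if `|h - wa| ≤ K_e w²`, `|h| ≤ Lw`, `|a| ≤ A`, `Lw ≤ 1/13`,
`w ≤ 1`, `2κw ≤ 1`, `κ ≥ 0`, then
`exp(wκ(G(x+h) - G(x))) ≤ 1 + w²κ a G'(x) + K₂ w³` with
`K₂ = κ(40L² + 5K_e) + (5κA + κ(40L² + 5K_e))²`. [folklore] -/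
theorem ig_exp_corr_diff_le {κ w h a x Ke L A : ℝ} (hκ : 0 ≤ κ) (hw0 : 0 < w) (hw1 : w ≤ 1)
    (hκw : 2 * κ * w ≤ 1) (hKe : 0 ≤ Ke) (hA : 0 ≤ A)
    (hha : |h - w * a| ≤ Ke * w ^ 2) (hh : |h| ≤ L * w) (hLw : L * w ≤ 1 / 13) (ha : |a| ≤ A) :
    Real.exp (w * κ * (igCorr (x + h) - igCorr x)) ≤
      1 + w ^ 2 * κ * a * igCorrDeriv x +
        (κ * (40 * L ^ 2 + 5 * Ke) + (5 * κ * A + κ * (40 * L ^ 2 + 5 * Ke)) ^ 2) * w ^ 3 := by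
  set K₁ := κ * (40 * L ^ 2 + 5 * Ke) with hK₁
  set Z := 5 * κ * A + K₁ with hZ
  set z := w * κ * (igCorr (x + h) - igCorr x) with hz
  set z₀ := w ^ 2 * κ * a * igCorrDeriv x with hz₀
  have hK₁0 : 0 ≤ K₁ := by positivity
  have hG' := abs_igCorrDeriv_le x
  have hT := igCorr_taylor (y := x) (h := h) (hh.trans hLw)
  -- |z - z₀| ≤ K₁ w³
  have hzz : |z - z₀| ≤ K₁ * w ^ 3 := by
    have hsplit : z - z₀ = w * κ * ((igCorr (x + h) - igCorr x - h * igCorrDeriv x) +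
        (h - w * a) * igCorrDeriv x) := by rw [hz, hz₀]; ring
    rw [hsplit, abs_mul, abs_mul, abs_of_pos hw0, abs_of_nonneg hκ]
    have h1 : |igCorr (x + h) - igCorr x - h * igCorrDeriv x| ≤ 40 * L ^ 2 * w ^ 2 := by
      refine hT.trans ?_
      have : h ^ 2 = |h| ^ 2 := (sq_abs h).symm
      rw [this]
      calc 40 * |h| ^ 2 ≤ 40 * (L * w) ^ 2 := by gcongr
        _ = 40 * L ^ 2 * w ^ 2 := by ring
    have h2 : |(h - w * a) * igCorrDeriv x| ≤ Ke * w ^ 2 * 5 := by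
      rw [abs_mul]
      exact mul_le_mul hha hG' (abs_nonneg _) (by positivity)
    calc w * κ * |igCorr (x + h) - igCorr x - h * igCorrDeriv x + (h - w * a) * igCorrDeriv x|
        ≤ w * κ * (40 * L ^ 2 * w ^ 2 + Ke * w ^ 2 * 5) := by
          gcongr
          exact (abs_add_le _ _).trans (add_le_add h1 h2)
      _ = K₁ * w ^ 3 := by rw [hK₁]; ring
  -- |z₀| ≤ 5κA w²
  have hz₀b : |z₀| ≤ 5 * κ * A * w ^ 2 := by
    rw [hz₀, abs_mul, abs_mul, abs_mul, abs_of_nonneg (sq_nonneg w), abs_of_nonneg hκ]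
    calc w ^ 2 * κ * |a| * |igCorrDeriv x| ≤ w ^ 2 * κ * A * 5 := by gcongr
      _ = 5 * κ * A * w ^ 2 := by ring
  -- |z| ≤ 1 and |z| ≤ Z w²
  have hz1 : |z| ≤ 1 := by
    rw [hz, abs_mul, abs_mul, abs_of_pos hw0, abs_of_nonneg hκ]
    have : |igCorr (x + h) - igCorr x| ≤ 2 := by
      calc |igCorr (x + h) - igCorr x| ≤ |igCorr (x + h)| + |igCorr x| := abs_sub _ _
        _ ≤ 1 + 1 := add_le_add (abs_igCorr_le _) (abs_igCorr_le _)
        _ = 2 := by norm_num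
    calc w * κ * |igCorr (x + h) - igCorr x| ≤ w * κ * 2 := by gcongr
      _ = 2 * κ * w := by ring
      _ ≤ 1 := hκw
  have hw32 : w ^ 3 ≤ w ^ 2 := by nlinarith
  have hzZ : |z| ≤ Z * w ^ 2 := by
    calc |z| = |z₀ + (z - z₀)| := by ring_nf
      _ ≤ |z₀| + |z - z₀| := abs_add_le _ _
      _ ≤ 5 * κ * A * w ^ 2 + K₁ * w ^ 3 := add_le_add hz₀b hzz
      _ ≤ 5 * κ * A * w ^ 2 + K₁ * w ^ 2 := by gcongr
      _ = Z * w ^ 2 := by rw [hZ]; ring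
  have hZ0 : 0 ≤ Z := by positivity
  have hzsq : z ^ 2 ≤ Z ^ 2 * w ^ 3 := by
    have : z ^ 2 = |z| ^ 2 := (sq_abs z).symm
    rw [this]
    calc |z| ^ 2 ≤ (Z * w ^ 2) ^ 2 := by gcongr
      _ = Z ^ 2 * (w ^ 4) := by ring
      _ ≤ Z ^ 2 * w ^ 3 :=
          mul_le_mul_of_nonneg_left (by nlinarith [pow_pos hw0 2, pow_pos hw0 3]) (sq_nonneg Z)
  have hexp : Real.exp z ≤ 1 + z + z ^ 2 := by
    have := (abs_le.mp (Real.abs_exp_sub_one_sub_id_le hz1)).2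
    linarith
  have hzle : z ≤ z₀ + K₁ * w ^ 3 := by linarith [(abs_le.mp hzz).2]
  calc Real.exp z ≤ 1 + z + z ^ 2 := hexp
    _ ≤ 1 + (z₀ + K₁ * w ^ 3) + Z ^ 2 * w ^ 3 := by linarith
    _ = 1 + z₀ + (K₁ + Z ^ 2) * w ^ 3 := by ring

/-- **Algebra of the product of the two one-step expansions**: if `0 ≤ F ≤ 1 + m + r₁`,
`0 ≤ E ≤ 1 + z + r₂`, `|m| ≤ A₁w`, `0 ≤ r₁ ≤ B₁w³`, `|z| ≤ A₂w²`, `0 ≤ r₂ ≤ B₂w³`, `0 < w ≤ 1`, then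
`F E ≤ 1 + m + z + (B₁ + B₂ + A₁A₂ + A₁B₂ + B₁A₂ + B₁B₂) w³`. [folklore] -/
theorem ig_prod_expansion_le {F E m r₁ z r₂ w A₁ B₁ A₂ B₂ : ℝ} (hw0 : 0 < w) (hw1 : w ≤ 1)
    (hF0 : 0 ≤ F) (hF : F ≤ 1 + m + r₁) (hE0 : 0 ≤ E) (hE : E ≤ 1 + z + r₂)
    (hm : |m| ≤ A₁ * w) (hr₁0 : 0 ≤ r₁) (hr₁ : r₁ ≤ B₁ * w ^ 3) (hz : |z| ≤ A₂ * w ^ 2)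
    (hr₂0 : 0 ≤ r₂) (hr₂ : r₂ ≤ B₂ * w ^ 3) :
    F * E ≤ 1 + m + z + (B₁ + B₂ + A₁ * A₂ + A₁ * B₂ + B₁ * A₂ + B₁ * B₂) * w ^ 3 := by
  have hA₁ : 0 ≤ A₁ * w := (abs_nonneg m).trans hm
  have hA₂ : 0 ≤ A₂ * w ^ 2 := (abs_nonneg z).trans hz
  have hw3 : w ^ 3 ≤ 1 := pow_le_one₀ hw0.le hw1
  have hw2 : w ^ 2 ≤ 1 := pow_le_one₀ hw0.le hw1
  have h1 : m * z ≤ A₁ * A₂ * w ^ 3 := by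
    calc m * z ≤ |m * z| := le_abs_self _
      _ = |m| * |z| := abs_mul _ _
      _ ≤ (A₁ * w) * (A₂ * w ^ 2) := mul_le_mul hm hz (abs_nonneg z) hA₁
      _ = A₁ * A₂ * w ^ 3 := by ring
  have h2 : m * r₂ ≤ A₁ * B₂ * w ^ 3 := by
    calc m * r₂ ≤ |m| * r₂ := by nlinarith [le_abs_self m]
      _ ≤ (A₁ * w) * (B₂ * w ^ 3) := mul_le_mul hm hr₂ hr₂0 hA₁
      _ = A₁ * B₂ * w ^ 3 * w := by ring
      _ ≤ A₁ * B₂ * w ^ 3 * 1 := by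
          apply mul_le_mul_of_nonneg_left hw1
          have : 0 ≤ A₁ * B₂ * w ^ 3 * w := by
            calc (0 : ℝ) ≤ (A₁ * w) * (B₂ * w ^ 3) := mul_nonneg hA₁ (hr₂0.trans hr₂)
              _ = A₁ * B₂ * w ^ 3 * w := by ring
          nlinarith
      _ = A₁ * B₂ * w ^ 3 := by ring
  have h3 : r₁ * z ≤ B₁ * A₂ * w ^ 3 := by
    calc r₁ * z ≤ r₁ * |z| := by nlinarith [le_abs_self z]
      _ ≤ (B₁ * w ^ 3) * (A₂ * w ^ 2) := mul_le_mul hr₁ hz (abs_nonneg z) (hr₁0.trans hr₁)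
      _ = B₁ * A₂ * w ^ 3 * w ^ 2 := by ring
      _ ≤ B₁ * A₂ * w ^ 3 * 1 := by
          apply mul_le_mul_of_nonneg_left hw2
          have : 0 ≤ B₁ * A₂ * w ^ 3 * w ^ 2 := by
            calc (0 : ℝ) ≤ (B₁ * w ^ 3) * (A₂ * w ^ 2) := mul_nonneg (hr₁0.trans hr₁) hA₂
              _ = B₁ * A₂ * w ^ 3 * w ^ 2 := by ring
          nlinarith [pow_pos hw0 2]
      _ = B₁ * A₂ * w ^ 3 := by ring
  have h4 : r₁ * r₂ ≤ B₁ * B₂ * w ^ 3 := by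
    calc r₁ * r₂ ≤ (B₁ * w ^ 3) * (B₂ * w ^ 3) := mul_le_mul hr₁ hr₂ hr₂0 (hr₁0.trans hr₁)
      _ = B₁ * B₂ * w ^ 3 * w ^ 3 := by ring
      _ ≤ B₁ * B₂ * w ^ 3 * 1 := by
          apply mul_le_mul_of_nonneg_left hw3
          have : 0 ≤ B₁ * B₂ * w ^ 3 * w ^ 3 := by
            calc (0 : ℝ) ≤ (B₁ * w ^ 3) * (B₂ * w ^ 3) := mul_nonneg (hr₁0.trans hr₁) (hr₂0.trans hr₂)
              _ = B₁ * B₂ * w ^ 3 * w ^ 3 := by ring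
          nlinarith [pow_pos hw0 3]
      _ = B₁ * B₂ * w ^ 3 := by ring
  have h1E : 0 ≤ 1 + m + r₁ := hF0.trans hF
  calc F * E ≤ (1 + m + r₁) * (1 + z + r₂) := mul_le_mul hF hE hE0 h1E
    _ = 1 + m + z + (r₁ + r₂ + m * z + m * r₂ + r₁ * z + r₁ * r₂) := by ring
    _ ≤ 1 + m + z + (B₁ * w ^ 3 + B₂ * w ^ 3 + A₁ * A₂ * w ^ 3 + A₁ * B₂ * w ^ 3 +
          B₁ * A₂ * w ^ 3 + B₁ * B₂ * w ^ 3) := by linarith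
    _ = 1 + m + z + (B₁ + B₂ + A₁ * A₂ + A₁ * B₂ + B₁ * A₂ + B₁ * B₂) * w ^ 3 := by ring

/-! ### The one-step estimate -/

/-- `|b| ≤ max(|b₋|,|b₊|)` on `[b₋, b₊]`. [folklore] -/
theorem ig_abs_le_max_abs_of_mem_Icc {bm bp b : ℝ} (hb : b ∈ Set.Icc bm bp) : |b| ≤ max |bm| |bp| := by
  rcases le_or_gt 0 b with h | h
  · rw [abs_of_nonneg h]
    exact le_trans (le_trans hb.2 (le_abs_self _)) (le_max_right _ _)
  · rw [abs_of_neg h]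
    exact le_trans (le_trans (neg_le_neg hb.1) (neg_le_abs _)) (le_max_left _ _)

/-- `|sin y cos y| ≤ 1/2`. [folklore] -/
theorem ig_abs_sin_mul_cos_le (y : ℝ) : |Real.sin y * Real.cos y| ≤ 1 / 2 := by
  have h1 := Real.sin_sq_add_cos_sq y
  rw [abs_le]
  constructor
  · nlinarith [sq_nonneg (Real.sin y + Real.cos y)]
  · nlinarith [sq_nonneg (Real.sin y - Real.cos y)]

/-- `|sin²y (6cos²y - 2)| ≤ 4`. [folklore] -/
theorem ig_abs_sin_sq_mul_le (y : ℝ) : |Real.sin y ^ 2 * (6 * Real.cos y ^ 2 - 2)| ≤ 4 := by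
  have h1 := Real.sin_sq_add_cos_sq y
  have hS2 : Real.sin y ^ 2 ≤ 1 := by nlinarith [sq_nonneg (Real.cos y)]
  have h64 : |6 * Real.cos y ^ 2 - 2| ≤ 4 := by
    rw [abs_le]; constructor <;> nlinarith [sq_nonneg (Real.sin y), sq_nonneg (Real.cos y)]
  rw [abs_mul, abs_of_nonneg (sq_nonneg _)]
  calc Real.sin y ^ 2 * |6 * Real.cos y ^ 2 - 2| ≤ 1 * 4 := by gcongr
    _ = 4 := one_mul _

/-- The main part of the factor expansion is `𝒪(δ)`: `|2δSC + δ²S²(6C²-2)| ≤ 2|δ|` for `|δ| ≤ 1/6`.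
[folklore] -/
theorem ig_abs_main_le {δ : ℝ} (hδ6 : |δ| ≤ 1 / 6) (y : ℝ) :
    |2 * δ * Real.sin y * Real.cos y + δ ^ 2 * Real.sin y ^ 2 * (6 * Real.cos y ^ 2 - 2)| ≤ 2 * |δ| := by
  have hδ0 := abs_nonneg δ
  have h1' : |2 * δ * Real.sin y * Real.cos y| ≤ |δ| := by
    rw [show 2 * δ * Real.sin y * Real.cos y = (2 * δ) * (Real.sin y * Real.cos y) by ring, abs_mul,
      abs_mul, abs_of_pos (by norm_num : (0 : ℝ) < 2)]
    calc 2 * |δ| * |Real.sin y * Real.cos y| ≤ 2 * |δ| * (1 / 2) := by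
          gcongr; exact ig_abs_sin_mul_cos_le y
      _ = |δ| := by ring
  have h2' : |δ ^ 2 * Real.sin y ^ 2 * (6 * Real.cos y ^ 2 - 2)| ≤ |δ| := by
    rw [mul_assoc, abs_mul, abs_of_nonneg (sq_nonneg δ)]
    have : δ ^ 2 = |δ| ^ 2 := (sq_abs δ).symm
    rw [this]
    calc |δ| ^ 2 * |Real.sin y ^ 2 * (6 * Real.cos y ^ 2 - 2)| ≤ |δ| ^ 2 * 4 := by
          gcongr; exact ig_abs_sin_sq_mul_le y
      _ = (4 * |δ|) * |δ| := by ring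
      _ ≤ 1 * |δ| := by gcongr; linarith
      _ = |δ| := one_mul _
  calc |2 * δ * Real.sin y * Real.cos y + δ ^ 2 * Real.sin y ^ 2 * (6 * Real.cos y ^ 2 - 2)|
      ≤ |2 * δ * Real.sin y * Real.cos y| + |δ ^ 2 * Real.sin y ^ 2 * (6 * Real.cos y ^ 2 - 2)| :=
        abs_add_le _ _
    _ ≤ |δ| + |δ| := add_le_add h1' h2'
    _ = 2 * |δ| := by ring

/-- The constant `K(κ, M, K_e, L)` of the one-step estimate (a polynomial in the variance `κ`, the
mass bound `M = max(|b₋|,|b₊|)` and the displacement constants of `ig_ahStep_displacement`).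
[folklore] -/
def igK (κ M Ke L : ℝ) : ℝ :=
  122 * (π * M) ^ 3 + (κ * (40 * L ^ 2 + 5 * Ke) + (5 * κ * (1 + M) + κ * (40 * L ^ 2 + 5 * Ke)) ^ 2) +
    (2 * π * M) * (5 * κ * (1 + M)) +
    (2 * π * M) * (κ * (40 * L ^ 2 + 5 * Ke) + (5 * κ * (1 + M) + κ * (40 * L ^ 2 + 5 * Ke)) ^ 2) +
    122 * (π * M) ^ 3 * (5 * κ * (1 + M)) +
    122 * (π * M) ^ 3 * (κ * (40 * L ^ 2 + 5 * Ke) + (5 * κ * (1 + M) + κ * (40 * L ^ 2 + 5 * Ke)) ^ 2)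

/-- `K ≥ 0`. [folklore] -/
theorem igK_nonneg {κ M Ke L : ℝ} (hκ : 0 ≤ κ) (hM : 0 ≤ M) (hKe : 0 ≤ Ke) : 0 ≤ igK κ M Ke L := by
  unfold igK
  positivity

/-- **Core of the one-step estimate**: under the quantitative smallness hypotheses on `w` (all
derived from `w ≤ w₀` in `ig_oneStep_pointwise`),
`(1/ahFactor(x,b)) e^{wκG(f_b(x))} ≤ [1 + 2cbSC + c²b²S²(6C²-2) + w²κ(1 + bS²)G'(x) + Kw³] e^{wκG(x)}`.
[cite: AjankiHuveneers2011, §4 Prop. 4.1 (proof)] -/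
theorem ig_oneStep_core {κ w x b M Ke L : ℝ} (hκ : 0 ≤ κ) (hw0 : 0 < w) (hw1 : w ≤ 1) (hM0 : 0 ≤ M)
    (hKe : 0 ≤ Ke) (hbM : |b| ≤ M) (ht : π * w / 2 * (1 + |b|) < 1)
    (hδ : |igDelta w b| ≤ π * M * w) (hδ6 : |igDelta w b| ≤ 1 / 6)
    (hd1 : |ahStep w b x - x - w * (1 + b * Real.sin (π * x) ^ 2)| ≤ Ke * w ^ 2)
    (hd2 : |ahStep w b x - x| ≤ L * w) (hLw : L * w ≤ 1 / 13) (hκw : 2 * κ * w ≤ 1) :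
    (ahFactor w x b)⁻¹ * Real.exp (w * κ * igCorr (ahStep w b x)) ≤
      (1 + 2 * igC w * b * Real.sin (π * x) * Real.cos (π * x) +
          igC w ^ 2 * b ^ 2 * Real.sin (π * x) ^ 2 * (6 * Real.cos (π * x) ^ 2 - 2) +
          w ^ 2 * κ * (1 + b * Real.sin (π * x) ^ 2) * igCorrDeriv x + igK κ M Ke L * w ^ 3) *
        Real.exp (w * κ * igCorr x) := by
  have hπ0 := Real.pi_pos
  have hpos := ig_ahFactor_pos (x := x) hw0.le ht
  have hmain := ig_abs_main_le hδ6 (π * x)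
  have hF' := ig_inv_sqrt_factor_le hδ6 x
  rw [← ig_ahFactor_inv_eq hw0.le ht] at hF'
  set S := Real.sin (π * x) with hS
  set C := Real.cos (π * x) with hC
  set δ := igDelta w b with hδdef
  have hδexp : δ = igC w * b := rfl
  have hδ0 := abs_nonneg δ
  -- (ii) the factor
  have hF : (ahFactor w x b)⁻¹ ≤ 1 + (2 * δ * S * C + δ ^ 2 * S ^ 2 * (6 * C ^ 2 - 2)) + 122 * |δ| ^ 3 := by
    linarith
  have hF0 : 0 ≤ (ahFactor w x b)⁻¹ := (inv_pos.mpr hpos).le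
  have hm : |2 * δ * S * C + δ ^ 2 * S ^ 2 * (6 * C ^ 2 - 2)| ≤ (2 * π * M) * w := by
    calc |2 * δ * S * C + δ ^ 2 * S ^ 2 * (6 * C ^ 2 - 2)| ≤ 2 * |δ| := hmain
      _ ≤ 2 * (π * M * w) := by gcongr
      _ = (2 * π * M) * w := by ring
  have hr₁ : 122 * |δ| ^ 3 ≤ (122 * (π * M) ^ 3) * w ^ 3 := by
    calc 122 * |δ| ^ 3 ≤ 122 * (π * M * w) ^ 3 := by gcongr
      _ = (122 * (π * M) ^ 3) * w ^ 3 := by ring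
  have hr₁0 : 0 ≤ 122 * |δ| ^ 3 := by positivity
  -- (iii) the corrector ratio
  set hh := ahStep w b x - x with hhh
  have hstep : ahStep w b x = x + hh := by rw [hhh]; ring
  have hS2 : S ^ 2 ≤ 1 := Real.sin_sq_le_one _
  have ha : |1 + b * S ^ 2| ≤ 1 + M := by
    calc |1 + b * S ^ 2| ≤ |(1 : ℝ)| + |b * S ^ 2| := abs_add_le _ _
      _ = 1 + |b| * S ^ 2 := by rw [abs_one, abs_mul, abs_of_nonneg (sq_nonneg S)]
      _ ≤ 1 + M * 1 := by gcongr
      _ = 1 + M := by ring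
  have hE := ig_exp_corr_diff_le (x := x) hκ hw0 hw1 hκw hKe (by positivity : (0 : ℝ) ≤ 1 + M)
    hd1 hd2 hLw ha
  have hE0 : 0 ≤ Real.exp (w * κ * (igCorr (x + hh) - igCorr x)) := (Real.exp_pos _).le
  have hz : |w ^ 2 * κ * (1 + b * S ^ 2) * igCorrDeriv x| ≤ (5 * κ * (1 + M)) * w ^ 2 := by
    rw [abs_mul, abs_mul, abs_mul, abs_of_nonneg (sq_nonneg w), abs_of_nonneg hκ]
    calc w ^ 2 * κ * |1 + b * S ^ 2| * |igCorrDeriv x| ≤ w ^ 2 * κ * (1 + M) * 5 := by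
          gcongr
          exact abs_igCorrDeriv_le x
      _ = (5 * κ * (1 + M)) * w ^ 2 := by ring
  have hr₂0 : 0 ≤ (κ * (40 * L ^ 2 + 5 * Ke) + (5 * κ * (1 + M) + κ * (40 * L ^ 2 + 5 * Ke)) ^ 2) * w ^ 3 := by
    positivity
  -- (iv) the product
  have hprod := ig_prod_expansion_le hw0 hw1 hF0 hF hE0 hE hm hr₁0 hr₁ hz hr₂0 le_rfl
  -- reassemble
  have hexp : Real.exp (w * κ * igCorr (ahStep w b x)) =
      Real.exp (w * κ * (igCorr (x + hh) - igCorr x)) * Real.exp (w * κ * igCorr x) := by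
    rw [← Real.exp_add, hstep]; ring_nf
  rw [hexp, ← mul_assoc]
  refine mul_le_mul_of_nonneg_right (hprod.trans (le_of_eq ?_)) (Real.exp_pos _).le
  rw [hδexp]
  unfold igK
  ring

/-- **The one-step estimate of the corrector argument, pointwise part** (replaces Lemmas 4.2–4.4
of the paper in the proof of Prop. 4.1). For a reduced-mass window `[b₋, b₊]` and `κ ≥ 0` there are
`w₀ ∈ (0, 1]` and `K ≥ 0` such that for `0 < w ≤ w₀`, all `x` and all `b ∈ [b₋, b₊]` the amplitude
factor is positive and, with `V = e^{wκG}`, `S = sin πx`, `C = cos πx`, `c = c(w)`,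
`(1/ahFactor(x,b)) · V(f_b(x)) ≤ [1 + 2cbSC + c²b²S²(6C²-2) + w²κ(1 + bS²)G'(x) + Kw³] · V(x)`.
[cite: AjankiHuveneers2011, §4 Prop. 4.1 (proof, eqs. (4.9)-(4.13))] -/
theorem ig_oneStep_pointwise (bm bp κ : ℝ) (hκ : 0 ≤ κ) :
    ∃ w₀ : ℝ, 0 < w₀ ∧ w₀ ≤ 1 ∧ ∃ K : ℝ, 0 ≤ K ∧
      ∀ w ∈ Set.Ioc 0 w₀, ∀ x : ℝ, ∀ b ∈ Set.Icc bm bp,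
        0 < ahFactor w x b ∧
        (ahFactor w x b)⁻¹ * Real.exp (w * κ * igCorr (ahStep w b x)) ≤
          (1 + 2 * igC w * b * Real.sin (π * x) * Real.cos (π * x) +
              igC w ^ 2 * b ^ 2 * Real.sin (π * x) ^ 2 * (6 * Real.cos (π * x) ^ 2 - 2) +
              w ^ 2 * κ * (1 + b * Real.sin (π * x) ^ 2) * igCorrDeriv x + K * w ^ 3) *
            Real.exp (w * κ * igCorr x) := by
  obtain ⟨w₁, hw₁, hw₁1, Ke, hKe, L, hL, hdisp⟩ := ig_ahStep_displacement bm bp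
  obtain ⟨M, hM⟩ : ∃ M : ℝ, M = max |bm| |bp| := ⟨_, rfl⟩
  have hM0 : 0 ≤ M := hM ▸ le_max_of_le_left (abs_nonneg _)
  have hπ0 := Real.pi_pos
  -- the threshold
  obtain ⟨w₀, hw₀⟩ : ∃ w₀ : ℝ, w₀ = min (min w₁ (1 / (6 * π * (1 + M))))
      (min (1 / (13 * L + 1)) (1 / (2 * κ + 1))) := ⟨_, rfl⟩
  have hw₀pos : 0 < w₀ := by rw [hw₀]; positivity
  have hw₀1 : w₀ ≤ w₁ := by rw [hw₀]; exact (min_le_left _ _).trans (min_le_left _ _)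
  have hw₀2 : w₀ ≤ 1 / (6 * π * (1 + M)) := by rw [hw₀]; exact (min_le_left _ _).trans (min_le_right _ _)
  have hw₀3 : w₀ ≤ 1 / (13 * L + 1) := by rw [hw₀]; exact (min_le_right _ _).trans (min_le_left _ _)
  have hw₀4 : w₀ ≤ 1 / (2 * κ + 1) := by rw [hw₀]; exact (min_le_right _ _).trans (min_le_right _ _)
  refine ⟨w₀, hw₀pos, hw₀1.trans hw₁1, igK κ M Ke L, igK_nonneg hκ hM0 hKe, ?_⟩
  intro w hw x b hb
  obtain ⟨hw0, hwle⟩ := hw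
  have hw1 : w ≤ 1 := (hwle.trans hw₀1).trans hw₁1
  have hbM : |b| ≤ M := hM ▸ ig_abs_le_max_abs_of_mem_Icc hb
  have hπw0 : 0 ≤ π * w := by positivity
  -- π w (1 + M) ≤ 1/6
  have hπwM : π * w * (1 + M) ≤ 1 / 6 := by
    have h1 := hwle.trans hw₀2
    rw [le_div_iff₀ (by positivity)] at h1
    linarith
  have hπw : π * w ≤ 1 / 6 := (le_mul_of_one_le_right hπw0 (by linarith)).trans hπwM
  have hπwb : π * w * |b| ≤ π * w * M := mul_le_mul_of_nonneg_left hbM hπw0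
  have ht' : π * w * (1 + |b|) ≤ 1 / 6 := by linarith
  have ht : π * w / 2 * (1 + |b|) < 1 := by linarith
  have hc0 : 0 ≤ igC w := igC_nonneg hw0.le (by linarith)
  have hcle : igC w ≤ π * w := igC_le hw0.le (by linarith)
  have hδ : |igDelta w b| ≤ π * M * w := by
    unfold igDelta
    rw [abs_mul, abs_of_nonneg hc0]
    calc igC w * |b| ≤ (π * w) * M := mul_le_mul hcle hbM (abs_nonneg b) hπw0
      _ = π * M * w := by ring
  have hπMw : π * M * w ≤ 1 / 6 := by linarith
  have hδ6 : |igDelta w b| ≤ 1 / 6 := hδ.trans hπMw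
  obtain ⟨hd1, hd2⟩ := hdisp w ⟨hw0, hwle.trans hw₀1⟩ x b hb
  have hLw : L * w ≤ 1 / 13 := by
    have h1 := hwle.trans hw₀3
    rw [le_div_iff₀ (by positivity)] at h1
    linarith
  have hκw : 2 * κ * w ≤ 1 := by
    have h1 := hwle.trans hw₀4
    rw [le_div_iff₀ (by positivity)] at h1
    linarith
  exact ⟨ig_ahFactor_pos (x := x) hw0.le ht,
    ig_oneStep_core hκ hw0 hw1 hM0 hKe hbM ht hδ hδ6 hd1 hd2 hLw hκw⟩

/-- **The one-step estimate, averaged part**: for `κ > 0`, `K ≥ 0` there is `w₁ > 0` such that for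
`0 < w ≤ w₁` and all `x` the `τ`-average of the bracket of `ig_oneStep_pointwise` for ANY law with
`∫τ = 1`, `∫bτ = 0`, `∫b²τ = κ`, namely `1 + κc²S²(6C²-2) + w²κG'(x) + Kw³`, is `≤ e^{-κπ²w²/32}`:
`κc²S²(6C²-2) = w²κ q(x) + 𝒪(w⁴)` and the cell problem `q + G' = -π²/16`.
[cite: AjankiHuveneers2011, §4 Prop. 4.1 eq. (4.13)] -/
theorem ig_oneStep_avg (κ K : ℝ) (hκ : 0 < κ) (hK : 0 ≤ K) :
    ∃ w₁ : ℝ, 0 < w₁ ∧ ∀ w ∈ Set.Ioc 0 w₁, ∀ x : ℝ,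
      1 + κ * (igC w ^ 2 * Real.sin (π * x) ^ 2 * (6 * Real.cos (π * x) ^ 2 - 2)) +
          w ^ 2 * κ * igCorrDeriv x + K * w ^ 3 ≤
        Real.exp (-(κ * π ^ 2 / 32 * w ^ 2)) := by
  have hπ0 := Real.pi_pos
  have hπ4 := Real.pi_lt_d2
  refine ⟨min (1 / 4) (κ * π ^ 2 / (32 * (56 * κ + K))), by positivity, ?_⟩
  intro w hw x
  obtain ⟨hw0, hwle⟩ := hw
  have hw4 : w ≤ 1 / 4 := hwle.trans (min_le_left _ _)
  have hw1 : w ≤ 1 := by linarith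
  have hsmall : (56 * κ + K) * w ≤ κ * π ^ 2 / 32 := by
    have h1 := hwle.trans (min_le_right _ _)
    rw [le_div_iff₀ (by positivity)] at h1
    linarith
  have ht2 : π * w / 2 ≤ 1 / 2 := by
    have := mul_le_mul_of_nonneg_left hw4 hπ0.le
    linarith
  obtain ⟨hc1, hc2⟩ := igC_sq_bounds hw0.le ht2
  have hq := igQ_eq x
  have hcell := igQ_add_igCorrDeriv x
  have hP := ig_abs_sin_sq_mul_le (π * x)
  set S := Real.sin (π * x) with hS
  set C := Real.cos (π * x) with hC
  -- (πw/2)⁴ ≤ 7 w³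
  have ht4 : (π * w / 2) ^ 4 ≤ 7 * w ^ 3 := by
    have hπ2 : π ^ 2 ≤ 10 := by
      have h := pow_le_pow_left₀ hπ0.le hπ4.le 2
      norm_num at h
      linarith
    have heq : (π * w / 2) ^ 4 = π ^ 2 * π ^ 2 * w ^ 4 / 16 := by ring
    rw [heq]
    have hw43 : w ^ 4 ≤ w ^ 3 := pow_le_pow_of_le_one hw0.le hw1 (by norm_num)
    have : π ^ 2 * π ^ 2 * w ^ 4 ≤ 10 * 10 * w ^ 3 := by
      calc π ^ 2 * π ^ 2 * w ^ 4 ≤ 10 * 10 * w ^ 4 := by gcongr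
        _ ≤ 10 * 10 * w ^ 3 := by gcongr
    linarith
  -- κ c² S²(6C²-2) ≤ κ w² q + 56 κ w³
  have hsecond : (igC w ^ 2 - (π * w / 2) ^ 2) * (S ^ 2 * (6 * C ^ 2 - 2)) ≤ 56 * w ^ 3 := by
    calc (igC w ^ 2 - (π * w / 2) ^ 2) * (S ^ 2 * (6 * C ^ 2 - 2))
        ≤ |(igC w ^ 2 - (π * w / 2) ^ 2) * (S ^ 2 * (6 * C ^ 2 - 2))| := le_abs_self _
      _ = (igC w ^ 2 - (π * w / 2) ^ 2) * |S ^ 2 * (6 * C ^ 2 - 2)| := by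
          rw [abs_mul, abs_of_nonneg hc1]
      _ ≤ (2 * (π * w / 2) ^ 4) * 4 := mul_le_mul hc2 hP (abs_nonneg _) (by positivity)
      _ ≤ (2 * (7 * w ^ 3)) * 4 := by gcongr
      _ = 56 * w ^ 3 := by ring
  have hmain : κ * (igC w ^ 2 * S ^ 2 * (6 * C ^ 2 - 2)) ≤ κ * w ^ 2 * igQ x + 56 * κ * w ^ 3 := by
    have hsplit : κ * (igC w ^ 2 * S ^ 2 * (6 * C ^ 2 - 2)) =
        κ * w ^ 2 * (π ^ 2 / 4 * S ^ 2 * (6 * C ^ 2 - 2)) +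
          κ * ((igC w ^ 2 - (π * w / 2) ^ 2) * (S ^ 2 * (6 * C ^ 2 - 2))) := by ring
    rw [hsplit, ← hq]
    have := mul_le_mul_of_nonneg_left hsecond hκ.le
    linarith
  have hcomb : κ * w ^ 2 * igQ x + w ^ 2 * κ * igCorrDeriv x = -(κ * π ^ 2 / 16) * w ^ 2 := by
    have : κ * w ^ 2 * igQ x + w ^ 2 * κ * igCorrDeriv x = κ * w ^ 2 * (igQ x + igCorrDeriv x) := by ring
    rw [this, hcell]; ring
  have hw3 : (56 * κ + K) * w ^ 3 ≤ κ * π ^ 2 / 32 * w ^ 2 := by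
    have h := mul_le_mul_of_nonneg_right hsmall (sq_nonneg w)
    have : (56 * κ + K) * w * w ^ 2 = (56 * κ + K) * w ^ 3 := by ring
    linarith
  calc 1 + κ * (igC w ^ 2 * S ^ 2 * (6 * C ^ 2 - 2)) + w ^ 2 * κ * igCorrDeriv x + K * w ^ 3
      ≤ 1 + (κ * w ^ 2 * igQ x + 56 * κ * w ^ 3) + w ^ 2 * κ * igCorrDeriv x + K * w ^ 3 := by linarith
    _ = 1 - κ * π ^ 2 / 16 * w ^ 2 + (56 * κ + K) * w ^ 3 := by linarith [hcomb]
    _ ≤ 1 - κ * π ^ 2 / 32 * w ^ 2 := by linarith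
    _ = -(κ * π ^ 2 / 32 * w ^ 2) + 1 := by ring
    _ ≤ Real.exp (-(κ * π ^ 2 / 32 * w ^ 2)) := Real.add_one_le_exp _

end Literature.Barriers.AtomisticToContinuum.HeatConduction

end
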